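import Summits.QuantumAdvantage.QuantumAdvantage.Theses.CubicForrelation

/-!
# Route `CubicForrelation`, assembly item `Assembly` (stmt-QuantumAdvantage-13930)

`Assembly := PlLift → SignedCubicForrelationNotPrBPP → SignedCubicForrelationMemPromiseBQP →
QuantumAdvantage`, with

* `PlLift := BQP ⊆ BPP → PromiseBQP ⊆ PromiseBPP'` (promise lift, stmt-QuantumAdvantage-0250),
* `SignedCubicForrelationNotPrBPP := signedCF₂ ∉ PromiseBPP'` (thesis X, stmt-QuantumAdvantage-13931),
* `SignedCubicForrelationMemPromiseBQP := signedCF₂ ∈ PromiseBQP` (support, stmt-QuantumAdvantage-13934),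

where `signedCF₂` is the signed cubic 2-fold Forrelation promise problem (YES `Φ ≥ 3/5`,
NO `Φ ≤ -3/5`; `n` even, B₂-circuits of 𝔽₂-degree `≤ 3`).

Proof (classical propositional logic; the same script as the route's deciding theorem
`Theses.CubicForrelation.closes`): if the summit `QuantumAdvantage := ∃ L, L ∈ BQP ∧ L ∉ BPP`
fails then `BQP ⊆ BPP`, so `PlLift` gives `PromiseBQP ⊆ PromiseBPP'`; the third hypothesis puts
`signedCF₂` in `PromiseBQP`, hence in `PromiseBPP'`, contradicting the second hypothesis.
No new definitions; nothing about the cruxes themselves is proved here.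
-/

set_option linter.dupNamespace false -- D-0017: single-problem summit ⇒ `QuantumAdvantage.QuantumAdvantage` by design

namespace Summit.QuantumAdvantage.QuantumAdvantage.Theorems.CubicForrelation

/-- Settles `stmt-QuantumAdvantage-13930` (route `CubicForrelation`, assembly):
`PlLift → SignedCubicForrelationNotPrBPP → SignedCubicForrelationMemPromiseBQP → QuantumAdvantage`.
Under `¬ QuantumAdvantage` every `L ∈ BQP` lies in `BPP`, so the promise lift yields
`PromiseBQP ⊆ PromiseBPP'`, and membership of the signed cubic 2-fold Forrelation problem in
`PromiseBQP` contradicts its non-membership in `PromiseBPP'`. [folklore] -/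
theorem Assembly_proof :
    Summit.QuantumAdvantage.QuantumAdvantage.Theses.CubicForrelation.Assembly := by
  unfold Summit.QuantumAdvantage.QuantumAdvantage.Theses.CubicForrelation.Assembly
  intro h₁ h₂ h₃
  by_contra hQA
  refine h₂ (h₁ ?_ h₃)
  intro L hL
  by_contra hLn
  exact hQA ⟨L, hL, hLn⟩

end Summit.QuantumAdvantage.QuantumAdvantage.Theorems.CubicForrelation
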